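import Literature.NumberTheory.Automorphic.GLnLeviOrbitalDescent                      -- ★ `measurable_innerLIntegral`; brings ★ `InvariantQuotientChainRule` (`exists_lintegral_eq_mul_lintegral_innerLIntegral`, `innerLIntegral(_mk)`, `inclQuot(_mk)`, `continuous_inclQuot`)
import Literature.NumberTheory.Automorphic.GLnUnipotentRadicalUnimodular              -- ★ `exists_quotientMeasure_torus_eq_smul_map` (the `K N A` form of invariant measures on `GL_n(F) ⧸ A`), `isClosed_standardLeviGL`, `isCompact_glInt`
import Literature.NumberTheory.Automorphic.ReductionTheoryGLnConjugation              -- ★ `isClosed_upperUnitriangular`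
import Literature.NumberTheory.Rogawski1990.Ch4Sec10Bridge                            -- ★ `mem_epsCentralizer_iff` (brings ★ `Ch4Sec10`: `epsCentralizer`, `descEpsConj`, `epsOrbitalIntegral`)
import HarnessLib

/-!
# R90 · S6 «Ch. 14.1–14.5 stable trace formula» — CARD TB2a (rows E1.4.4.2.3 ∕ TB2d), FILE 1c: THE ε-TWISTED TORUS DESCENT `G̃ ⧸ G̃_{δε} → G̃ ⧸ M̃ → K̃ × Ñ`,
# HYPOTHESIS-DRIVEN in the twist of `Ñ`: `∫_{G̃ ⧸ G̃_{δε}} F(y δ ε(y)⁻¹) = c · J · ∫_{M̃ ⧸ G̃_{δε}} ∫_{K̃×Ñ} F(k ((a δ ε(a)⁻¹) n) ε(k)⁻¹)` (`Theorems/R90S6TwistedTorusDescent.lean`)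

Dealer R90-C14-plan (g2), CARD TB2a 2026-09-05T01:56:15Z and «=» 02:01:52Z: «YOUR FILE 1 = the ε-TWISTED IWASAWA UNFOLDING `G̃ = K̃·Ñ·M̃` at ε-regular diagonal `δ` with the
`Ñ`-change-of-variables modulus carried as a HYPOTHESIS LETTER (`hJ : …`) (hypothesis-driven exactly like ★ `TorusOrbitalDescentTwist`'s `J(t)`) … The Jacobian COMPUTATION is NOT
yours: dealt to p06 (g2) as TJ1»; CUT 02:10:22Z (FILE 1a `Theorems/R90S6CartierGL.lean` = the `GL_n` Cartier API; FILE 1b `Theorems/R90S6TwistedConstantTermTransport.lean` = the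
`K̃ × Ñ` level through the frame).  The 400-line rule puts the quotient-measure descent `G̃ ⧸ G̃_{δε} → M̃ ⧸ G̃_{δε} × K̃ × Ñ` in THIS companion FILE 1c, independent of 1a ∕ 1b;
FILE 2 (the value theorem with p06's TJ1 `J = D_G(N(δ))` and the `M̃`-fibre sum over p10's TL4) composes 1b + 1c.

THE MATHEMATICS [Rogawski1990, §4.10 pp. 57–59 (the ε-twisted orbital integral `Φ_ε(δ, φ) = ∫ φ(g⁻¹δε(g)) dg` and the twisted Weyl integration formula
«`Tr(π̃(φ)π̃(ε)) = ∫_{Z̃M̃^{1−ε}∖M̃} D_G(N(δ)) Φ_ε(δ,φ) χ(N(δ)) dδ`», proof of Prop. 4.10.2 p. 59); §4.13 Lemma 4.13.1 (a) p. 64 and its proof p. 70 («the quotient measure on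
`G ⧸ M` … `G = KP`, `P = MU`»)].  Let `G` be a locally compact second countable group, `ε : G →* G` continuous, `δ ∈ G` with CLOSED ε-centraliser `T = G_{δε}`
(★ `epsCentralizer`) contained in a closed subgroup `A` (the ε-stable Levi `M̃`; at an ε-regular diagonal `δ`, `G̃_{δε} ≅ G_γ ⊂ M̃`, ★ S4 `R90S4EpsCentralizerNormTorus`).
Integration in stages (★ `InvariantQuotientChainRule.exists_lintegral_eq_mul_lintegral_innerLIntegral`) gives `∫_{G ⧸ T} f = c ∫_{G ⧸ A} ∫_{A ⧸ T} f(g a T)`; the `K N A` LETTER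
`μ_{G∕A} = C • ((k, n) ↦ k n A)_* (κ ⊗ μ_N)` (★ `exists_quotientMeasure_torus_eq_smul_map` on `GL_n(F)`) turns the outer integral into `∫_{K×N}`; Tonelli swaps; and at
`y = k n a` the twisted integrand reads `F(y δ ε(y)⁻¹) = F(k · (n (a δ ε(a)⁻¹) ε(n)⁻¹) · ε(k)⁻¹)`, so the TWIST LETTER `hJac` (module `J` of `n ↦ n m ε(n)⁻¹` versus `n ↦ m n` on
`μ_N`, `m = a δ ε(a)⁻¹` — its VALUE `D_G(N(δ))` is p06 (g2)'s TJ1 `Theorems/R90S6TwistedUnipotentJacobian.lean`) yields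
`∫_{G ⧸ T} F(y δ ε(y)⁻¹) dμ_{G∕T} = c · C · J · ∫_{A ⧸ T} ∫_{K×N} F(k ((a δ ε(a)⁻¹) n) ε(k)⁻¹) d(κ ⊗ μ_N) dμ_{A∕T}(a)`.

* §1 (generic) private `descEpsConj_epsCentralizer_apply_mk` (`descEpsConj ε δ G_{δε} φ (gG_{δε}) = φ(g δ ε(g)⁻¹)`), private `measurable_descEpsConj_aux`,
  **`lintegral_prod_twistedConj_eq_mul_of_epsTwist`** (the twist step under `∫_{K×N}`), HEAD **`exists_lintegral_descEpsConj_eq_mul_lintegral_torus`** (the descent, both letters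
  as binders; outer integrand in the tree's currency `descEpsConj ε δ G_{δε} Ψ ∘ inclQuot G_{δε} A`).
* §2 (`GL_n(F)`, `F` a non-archimedean local field, `A = M_{id}`, `K = GL_n(𝒪)`, `N` upper unitriangular, ANY Haar `κ`, `μ_N`)
  **`exists_lintegral_descEpsConj_eq_mul_lintegral_torus_gl`** — the `K N A` letter DISCHARGED by ★ `exists_quotientMeasure_torus_eq_smul_map`; only `hJac` remains.

Cell `hodgecm-mathlib`, crux H413 (`stmt-HodgeConjecture-24833`), route of record `HCCMUnconditional`; programme R90-TF (brief `director/R90-BRIEF.v2.md` 1f40d54518340a35),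
section S6 (base `R90-C14`), seat R90-C14-p01 (g2).  Lane `--kind proof --supports stmt-HodgeConjecture-24833 --as helper`; THEOREMS ONLY (no definition, no instance, no notation,
no named fact, no kit, no `sorry`); imports ★ `GLnLeviOrbitalDescent` + ★ `GLnUnipotentRadicalUnimodular` + ★ `ReductionTheoryGLnConjugation` + ★ `Rogawski1990.Ch4Sec10Bridge` +
HarnessLib; never `Lines/`.  HONEST LABEL: quotient-measure bookkeeping, count-neutral until the (TB2d) value theorem consumes it with TJ1's `J`; proves no printed global statement,
discharges no citation; HC_CM is proved only modulo the 7 printed citations (2 remaining named inputs: hLiu418 = stmt-HodgeConjecture-24832, h413 = stmt-HodgeConjecture-24833)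
until rung 0 closes.

## Tree search
★ `TorusOrbitalDescentTwist` (untwisted, `T = A`: the template of the twist letter), ★ `GLnLeviOrbitalDescent.exists_lintegral_descConj_eq_mul_lintegral_levi` (untwisted, `T ≤ M_c`,
two blocks: the template of the proof; `measurable_innerLIntegral` reused), ★ `GLnUnipotentRadicalUnimodular.exists_quotientMeasure_torus_eq_smul_map` (the `K N A` letter on
`GL_n(F) ⧸ A`), ★ `InvariantQuotientChainRule` (`exists_lintegral_eq_mul_lintegral_innerLIntegral`, `innerLIntegral_mk`, `inclQuot_mk`, `continuous_inclQuot`), ★ `Rogawski1990.Ch4Sec10`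
(`descEpsConj`, `epsCentralizer`; ★ `Ch4Sec10Bridge.mem_epsCentralizer_iff`), ★ J1′ `R90S6TwistedOrbitalIndicatorCount` (`measurable_descEpsConj`, compact ε-centraliser — not
importable here without its shell kit; re-proved privately), ★ `isClosed_upperUnitriangular`, ★ `isClosed_standardLeviGL`, ★ `isCompact_glInt`.  Dedup:
`rg "descEpsConj_eq_mul_lintegral|_of_epsTwist"` over `lean/` — no hit.

## References
* [Rogawski1990] J. D. Rogawski, *Automorphic Representations of Unitary Groups in Three Variables*, Ann. of Math. Stud. 123 (1990): §4.10 pp. 57–59; §4.13 Lemma 4.13.1 (a) p. 64, p. 70.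
* [Gelbart1975] S. Gelbart, *Automorphic Forms on Adele Groups*, Ann. of Math. Stud. 83 (1975), Thm. 9.22 (iii) («`dg = da dn dk`»).
* [Folland1995] G. B. Folland, *A Course in Abstract Harmonic Analysis* (1995), §2.6 Thm. 2.49 (Weil's formula; integration in stages).
-/

set_option autoImplicit false
-- the mandated namespace repeats the single-problem summit's segment (`HodgeConjecture.HodgeConjecture`)
set_option linter.dupNamespace false

noncomputable section

open MeasureTheory Measure Set Function
open scoped ENNReal NNReal Pointwise
open Literature.NumberTheory.Automorphic

namespace Summit.HodgeConjecture.HodgeConjecture.R90.S6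

/-! ## §1 THE ε-TWISTED TORUS DESCENT `G ⧸ G_{δε} → G ⧸ A → K × N`, HYPOTHESIS-DRIVEN in the `K N A` form of `μ_{G∕A}` and in the twist of `N` -/

section TwistedDescent

open Literature.MeasureTheory.Group Literature.NumberTheory.Rogawski1990.Ch4Sec10

variable {G : Type*} [Group G] (ε : G →* G) (δ : G)

/-- **The descended twisted integrand on a coset**: `descEpsConj ε δ G_{δε} φ (g G_{δε}) = φ(g δ ε(g)⁻¹)` (the representative `out (g G_{δε}) = g m` with
`m ∈ G_{δε}` fixing `δ` under twisted conjugation; local restatement of the S4 ∕ J1′ lemma so that this generic file imports no CM carrier). [cite: Rogawski1990, §1.6 p. 5] -/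
private theorem descEpsConj_epsCentralizer_apply_mk {α : Type*} (φ : G → α) (g : G) :
    descEpsConj ε δ (epsCentralizer ε δ) φ (QuotientGroup.mk g : G ⧸ epsCentralizer ε δ) = φ (g * δ * (ε g)⁻¹) := by
  obtain ⟨m, hm⟩ := QuotientGroup.mk_out_eq_mul (epsCentralizer ε δ) g
  have hmδ : (m : G) * δ * (ε (m : G))⁻¹ = δ := (mem_epsCentralizer_iff ε δ _).1 m.2
  unfold descEpsConj
  rw [hm, map_mul]
  congr 1
  calc g * (m : G) * δ * (ε g * ε (m : G))⁻¹ = g * ((m : G) * δ * (ε (m : G))⁻¹) * (ε g)⁻¹ := by group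
    _ = g * δ * (ε g)⁻¹ := by rw [hmδ]

variable [TopologicalSpace G] [IsTopologicalGroup G] [MeasurableSpace G] [BorelSpace G]

/-- The descended twisted integrand of a Borel `φ` is Borel for a continuous `ε` (it is `φ` composed with the continuous map `y G_{δε} ↦ y δ ε(y)⁻¹`; local copy of
★ J1′ `measurable_descEpsConj`). [folklore] -/
private theorem measurable_descEpsConj_aux [MeasurableSpace (G ⧸ epsCentralizer ε δ)] [BorelSpace (G ⧸ epsCentralizer ε δ)] (hε : Continuous ε)
    {α : Type*} [MeasurableSpace α] {φ : G → α} (hφ : Measurable φ) :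
    Measurable (descEpsConj ε δ (epsCentralizer ε δ) φ) := by
  have hcomp : descEpsConj ε δ (epsCentralizer ε δ) (id : G → G) ∘ (QuotientGroup.mk : G → G ⧸ epsCentralizer ε δ) =
      fun g => g * δ * (ε g)⁻¹ :=
    funext fun g => descEpsConj_epsCentralizer_apply_mk ε δ id g
  have hcont : Continuous (descEpsConj ε δ (epsCentralizer ε δ) (id : G → G)) := by
    rw [← QuotientGroup.isOpenQuotientMap_mk.continuous_comp_iff, hcomp]
    exact (continuous_id.mul continuous_const).mul (hε.comp continuous_id).inv
  have heq : descEpsConj ε δ (epsCentralizer ε δ) φ = φ ∘ descEpsConj ε δ (epsCentralizer ε δ) (id : G → G) := rfl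
  rw [heq]
  exact hφ.comp hcont.measurable

variable [LocallyCompactSpace G] [SecondCountableTopology G] [T2Space G]
  {K N : Subgroup G} (κ : Measure ↥K) [SFinite κ] (μN : Measure ↥N) [SFinite μN]

omit [LocallyCompactSpace G] [T2Space G] [SFinite κ] in
/-- **The twist step (ε-twisted).** If the self-map `n ↦ n m ε(n)⁻¹` of `N` at `m` has module `J` on `μ_N` in the INTEGRAL form
`∫_N Φ(n m ε(n)⁻¹) dμ_N = J · ∫_N Φ(m n) dμ_N` (the PROPERTY binder `hJac` — for `N = Ñ` the upper unipotent radical of `GL₃(E_w)` at an ε-regular diagonal `m` this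
is the `D_G(N(m))` of the twisted Weyl integration formula, [Rogawski1990] p. 59), then for the `K × N` integral:
`∫_{K×N} F(k (n m ε(n)⁻¹) ε(k)⁻¹) = J · ∫_{K×N} F(k (m n) ε(k)⁻¹)` (Tonelli, `hJac` at `Φ = F(k · ε(k)⁻¹)` for each `k`). [cite: Rogawski1990, §4.10 p. 59; §4.13 p. 70] -/
theorem lintegral_prod_twistedConj_eq_mul_of_epsTwist (hε : Continuous ε) (m : G) {J : ℝ≥0∞}
    (hJac : ∀ Φ : G → ℝ≥0∞, Measurable Φ → ∫⁻ n, Φ ((n : G) * m * (ε (n : G))⁻¹) ∂μN = J * ∫⁻ n, Φ (m * (n : G)) ∂μN)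
    {F : G → ℝ≥0∞} (hF : Measurable F) :
    ∫⁻ q : ↥K × ↥N, F ((q.1 : G) * ((q.2 : G) * m * (ε (q.2 : G))⁻¹) * (ε (q.1 : G))⁻¹) ∂(κ.prod μN) =
      J * ∫⁻ q : ↥K × ↥N, F ((q.1 : G) * (m * (q.2 : G)) * (ε (q.1 : G))⁻¹) ∂(κ.prod μN) := by
  haveI : BorelSpace ↥K := Subtype.borelSpace _
  haveI : BorelSpace ↥N := Subtype.borelSpace _
  haveI : SecondCountableTopology ↥K := TopologicalSpace.Subtype.secondCountableTopology _
  haveI : SecondCountableTopology ↥N := TopologicalSpace.Subtype.secondCountableTopology _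
  haveI : BorelSpace (↥K × ↥N) := Prod.borelSpace
  have h1 : Measurable fun q : ↥K × ↥N => F ((q.1 : G) * ((q.2 : G) * m * (ε (q.2 : G))⁻¹) * (ε (q.1 : G))⁻¹) :=
    hF.comp (((continuous_subtype_val.comp continuous_fst).mul
      (((continuous_subtype_val.comp continuous_snd).mul continuous_const).mul
        (hε.comp (continuous_subtype_val.comp continuous_snd)).inv)).mul
      (hε.comp (continuous_subtype_val.comp continuous_fst)).inv).measurable
  have h2 : Measurable fun q : ↥K × ↥N => F ((q.1 : G) * (m * (q.2 : G)) * (ε (q.1 : G))⁻¹) :=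
    hF.comp (((continuous_subtype_val.comp continuous_fst).mul
      (continuous_const.mul (continuous_subtype_val.comp continuous_snd))).mul
      (hε.comp (continuous_subtype_val.comp continuous_fst)).inv).measurable
  have hk : ∀ k : ↥K, ∫⁻ n : ↥N, F ((k : G) * ((n : G) * m * (ε (n : G))⁻¹) * (ε (k : G))⁻¹) ∂μN =
      J * ∫⁻ n : ↥N, F ((k : G) * (m * (n : G)) * (ε (k : G))⁻¹) ∂μN := fun k =>
    hJac (fun g => F ((k : G) * g * (ε (k : G))⁻¹)) (hF.comp ((continuous_const.mul continuous_id).mul continuous_const).measurable)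
  have hmeas : Measurable fun k : ↥K => ∫⁻ n : ↥N, F ((k : G) * (m * (n : G)) * (ε (k : G))⁻¹) ∂μN := h2.lintegral_prod_right'
  calc ∫⁻ q : ↥K × ↥N, F ((q.1 : G) * ((q.2 : G) * m * (ε (q.2 : G))⁻¹) * (ε (q.1 : G))⁻¹) ∂(κ.prod μN)
      = ∫⁻ k : ↥K, ∫⁻ n : ↥N, F ((k : G) * ((n : G) * m * (ε (n : G))⁻¹) * (ε (k : G))⁻¹) ∂μN ∂κ := lintegral_prod _ h1.aemeasurable
    _ = ∫⁻ k : ↥K, J * ∫⁻ n : ↥N, F ((k : G) * (m * (n : G)) * (ε (k : G))⁻¹) ∂μN ∂κ := lintegral_congr hk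
    _ = J * ∫⁻ k : ↥K, ∫⁻ n : ↥N, F ((k : G) * (m * (n : G)) * (ε (k : G))⁻¹) ∂μN ∂κ := lintegral_const_mul J hmeas
    _ = J * ∫⁻ q : ↥K × ↥N, F ((q.1 : G) * (m * (q.2 : G)) * (ε (q.1 : G))⁻¹) ∂(κ.prod μN) := by rw [lintegral_prod _ h2.aemeasurable]

/-- **THE ε-TWISTED TORUS DESCENT, HYPOTHESIS-DRIVEN** (the ε-twin of ★ `TorusOrbitalDescentTwist` ∕ ★ `GLnLeviOrbitalDescent.exists_lintegral_descConj_eq_mul_lintegral_levi`).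
Let `G` be a locally compact second countable Hausdorff group, `ε : G →* G` continuous, `δ ∈ G`, `A ≤ G` closed (the ε-stable Levi `M̃`) containing the CLOSED ε-centraliser
`T = G_{δε}` (`hTA` — at an ε-regular diagonal `δ` this is «`G̃_{δε} ≅ G_γ ⊂ M̃`», ★ S4 `R90S4EpsCentralizerNormTorus`), `μ_{G∕T}`, `μ_{G∕A}`, `μ_{A∕T}` non-zero invariant Radon
measures, `κ`, `μ_N` s-finite measures on `K`, `N ≤ G`, and TWO PROPERTY BINDERS: the `K N A` LETTER `hμGA : μ_{G∕A} = C • ((k,n) ↦ k n A)_* (κ ⊗ μ_N)` (on `GL_n(F)` the OUTPUT of ★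
`exists_quotientMeasure_torus_eq_smul_map`) and the TWIST LETTER `hJac` (ONE module `J` for the maps `n ↦ n (a δ ε(a)⁻¹) ε(n)⁻¹`, `a ∈ A` — the `D_G(N(δ))` of p. 59).  Then there is
ONE `c ∈ (0, ∞)` (from integration in stages alone) with, for every Borel `F ≥ 0`,
**`∫⁻_{G ⧸ T} F(y δ ε(y)⁻¹) dμ_{G∕T} = c · C · J · ∫⁻_{A ⧸ T} ( ∫⁻_{K×N} F(k ((a δ ε(a)⁻¹) n) ε(k)⁻¹) d(κ ⊗ μ_N) ) dμ_{A∕T}(a)`** — integration in stages `G ⧸ T → G ⧸ A`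
(★ `exists_lintegral_eq_mul_lintegral_innerLIntegral`), the `K N A` letter, Tonelli, and the twist step at `m = a δ ε(a)⁻¹` (`y = k n a` gives
`y δ ε(y)⁻¹ = k · (n (a δ ε(a)⁻¹) ε(n)⁻¹) · ε(k)⁻¹`).  The outer integrand is written in the tree's currency `descEpsConj ε δ T Ψ ∘ inclQuot T A`.
[cite: Rogawski1990, §4.10 pp. 57–59; §4.13 Lemma 4.13.1 (a) p. 64 and p. 70] [cite: Folland1995, §2.6 Thm. 2.49] -/
theorem exists_lintegral_descEpsConj_eq_mul_lintegral_torus (hε : Continuous ε) {A : Subgroup G} (hA : IsClosed (A : Set G))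
    (hT : IsClosed (epsCentralizer ε δ : Set G)) (hTA : epsCentralizer ε δ ≤ A)
    [MeasurableSpace (G ⧸ epsCentralizer ε δ)] [BorelSpace (G ⧸ epsCentralizer ε δ)] [MeasurableSpace (G ⧸ A)] [BorelSpace (G ⧸ A)]
    [MeasurableSpace (↥A ⧸ (epsCentralizer ε δ).subgroupOf A)] [BorelSpace (↥A ⧸ (epsCentralizer ε δ).subgroupOf A)]
    (μGT : Measure (G ⧸ epsCentralizer ε δ)) [SMulInvariantMeasure G (G ⧸ epsCentralizer ε δ) μGT] [IsFiniteMeasureOnCompacts μGT] (hGT : μGT ≠ 0)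
    (μGA : Measure (G ⧸ A)) [SMulInvariantMeasure G (G ⧸ A) μGA] [IsFiniteMeasureOnCompacts μGA] (hGA : μGA ≠ 0)
    (μAT : Measure (↥A ⧸ (epsCentralizer ε δ).subgroupOf A)) [SMulInvariantMeasure ↥A (↥A ⧸ (epsCentralizer ε δ).subgroupOf A) μAT]
    [IsFiniteMeasureOnCompacts μAT] (hAT : μAT ≠ 0)
    {C : ℝ≥0} (hμGA : μGA = C • Measure.map (fun p : ↥K × ↥N => (QuotientGroup.mk ((p.1 : G) * (p.2 : G)) : G ⧸ A)) (κ.prod μN)) :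
    ∃ c : ℝ≥0∞, c ≠ 0 ∧ c ≠ ∞ ∧ ∀ {J : ℝ≥0∞}
      (_hJac : ∀ a : ↥A, ∀ Φ : G → ℝ≥0∞, Measurable Φ →
        ∫⁻ n, Φ ((n : G) * ((a : G) * δ * (ε (a : G))⁻¹) * (ε (n : G))⁻¹) ∂μN = J * ∫⁻ n, Φ (((a : G) * δ * (ε (a : G))⁻¹) * (n : G)) ∂μN)
      (F : G → ℝ≥0∞), Measurable F →
      ∫⁻ y, descEpsConj ε δ (epsCentralizer ε δ) F y ∂μGT =
        c * C * J * ∫⁻ z, descEpsConj ε δ (epsCentralizer ε δ)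
          (fun m : G => ∫⁻ q : ↥K × ↥N, F ((q.1 : G) * (m * (q.2 : G)) * (ε (q.1 : G))⁻¹) ∂(κ.prod μN))
          (inclQuot (epsCentralizer ε δ) A z) ∂μAT := by
  haveI : IsClosed ((epsCentralizer ε δ : Subgroup G) : Set G) := hT
  haveI : IsClosed ((A : Subgroup G) : Set G) := hA
  haveI : BorelSpace ↥K := Subtype.borelSpace _
  haveI : BorelSpace ↥N := Subtype.borelSpace _
  haveI : SecondCountableTopology ↥K := TopologicalSpace.Subtype.secondCountableTopology _
  haveI : SecondCountableTopology ↥N := TopologicalSpace.Subtype.secondCountableTopology _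
  haveI : BorelSpace (↥K × ↥N) := Prod.borelSpace
  haveI : LocallyCompactSpace ↥A := hA.isClosedEmbedding_subtypeVal.locallyCompactSpace
  haveI : SecondCountableTopology ↥A := TopologicalSpace.Subtype.secondCountableTopology _
  haveI : SecondCountableTopology (↥A ⧸ (epsCentralizer ε δ).subgroupOf A) := inferInstance
  haveI : SFinite μAT := inferInstance
  haveI : BorelSpace ((↥K × ↥N) × (↥A ⧸ (epsCentralizer ε δ).subgroupOf A)) := Prod.borelSpace
  haveI : BorelSpace (G × (↥K × ↥N)) := Prod.borelSpace
  -- (1) integration in stages `G ⧸ T → G ⧸ A`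
  obtain ⟨c, hc, hc', hchain⟩ := exists_lintegral_eq_mul_lintegral_innerLIntegral (epsCentralizer ε δ) A μGT μGA μAT hTA hGT hGA hAT
  refine ⟨c, hc, hc', fun {J} hJac F hF => ?_⟩
  have hf : Measurable (descEpsConj ε δ (epsCentralizer ε δ) F) := measurable_descEpsConj_aux ε δ hε hF
  have hπ : Measurable fun q : ↥K × ↥N => (QuotientGroup.mk ((q.1 : G) * (q.2 : G)) : G ⧸ A) :=
    ((QuotientGroup.continuous_mk (N := A)).comp
      ((continuous_subtype_val.comp continuous_fst).mul (continuous_subtype_val.comp continuous_snd))).measurable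
  -- (2) the `K N A` letter
  rw [hchain _ hf, hμGA, lintegral_smul_measure, lintegral_map (measurable_innerLIntegral (epsCentralizer ε δ) A μAT hA hf) hπ]
  have hmk : ∀ q : ↥K × ↥N, innerLIntegral (epsCentralizer ε δ) A μAT (descEpsConj ε δ (epsCentralizer ε δ) F)
        (QuotientGroup.mk ((q.1 : G) * (q.2 : G))) =
      ∫⁻ z, descEpsConj ε δ (epsCentralizer ε δ) F (((q.1 : G) * (q.2 : G)) • inclQuot (epsCentralizer ε δ) A z) ∂μAT :=
    fun q => innerLIntegral_mk _ _ _ _ _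
  rw [lintegral_congr hmk]
  -- (3) Tonelli: swap `K × N` and `A ⧸ T`
  have hjoint : Measurable fun r : (↥K × ↥N) × (↥A ⧸ (epsCentralizer ε δ).subgroupOf A) =>
      descEpsConj ε δ (epsCentralizer ε δ) F (((r.1.1 : G) * (r.1.2 : G)) • inclQuot (epsCentralizer ε δ) A r.2) :=
    hf.comp ((((continuous_subtype_val.comp continuous_fst).mul (continuous_subtype_val.comp continuous_snd)).comp continuous_fst).smul
      ((continuous_inclQuot (epsCentralizer ε δ) A).comp continuous_snd)).measurable
  rw [lintegral_lintegral_swap hjoint.aemeasurable]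
  -- (4) the inner `K × N` integral at `z = a T`: the twist step at `m = a δ ε(a)⁻¹`
  have hinner : ∀ z : ↥A ⧸ (epsCentralizer ε δ).subgroupOf A,
      ∫⁻ q : ↥K × ↥N, descEpsConj ε δ (epsCentralizer ε δ) F (((q.1 : G) * (q.2 : G)) • inclQuot (epsCentralizer ε δ) A z) ∂(κ.prod μN) =
        J * descEpsConj ε δ (epsCentralizer ε δ)
          (fun m : G => ∫⁻ q : ↥K × ↥N, F ((q.1 : G) * (m * (q.2 : G)) * (ε (q.1 : G))⁻¹) ∂(κ.prod μN))
          (inclQuot (epsCentralizer ε δ) A z) := by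
    intro z
    induction z using QuotientGroup.induction_on with
    | H a =>
      have hpt : ∀ q : ↥K × ↥N, descEpsConj ε δ (epsCentralizer ε δ) F
            (((q.1 : G) * (q.2 : G)) • inclQuot (epsCentralizer ε δ) A (QuotientGroup.mk a)) =
          F ((q.1 : G) * ((q.2 : G) * ((a : G) * δ * (ε (a : G))⁻¹) * (ε (q.2 : G))⁻¹) * (ε (q.1 : G))⁻¹) := by
        intro q
        rw [inclQuot_mk, MulAction.Quotient.smul_mk, smul_eq_mul, descEpsConj_epsCentralizer_apply_mk, map_mul, map_mul]
        congr 1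
        group
      rw [lintegral_congr hpt, lintegral_prod_twistedConj_eq_mul_of_epsTwist ε κ μN hε _ (hJac a) hF]
      simp only [inclQuot_mk, descEpsConj_epsCentralizer_apply_mk]
  -- measurability of the outer integrand
  have hΨ : Measurable fun m : G => ∫⁻ q : ↥K × ↥N, F ((q.1 : G) * (m * (q.2 : G)) * (ε (q.1 : G))⁻¹) ∂(κ.prod μN) := by
    refine Measurable.lintegral_prod_right' (f := fun r : G × (↥K × ↥N) => F ((r.2.1 : G) * (r.1 * (r.2.2 : G)) * (ε (r.2.1 : G))⁻¹)) ?_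
    exact hF.comp ((((continuous_subtype_val.comp (continuous_fst.comp continuous_snd)).mul
      (continuous_fst.mul (continuous_subtype_val.comp (continuous_snd.comp continuous_snd)))).mul
      (hε.comp (continuous_subtype_val.comp (continuous_fst.comp continuous_snd))).inv).measurable)
  have houter : Measurable fun z : ↥A ⧸ (epsCentralizer ε δ).subgroupOf A => descEpsConj ε δ (epsCentralizer ε δ)
      (fun m : G => ∫⁻ q : ↥K × ↥N, F ((q.1 : G) * (m * (q.2 : G)) * (ε (q.1 : G))⁻¹) ∂(κ.prod μN)) (inclQuot (epsCentralizer ε δ) A z) :=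
    (measurable_descEpsConj_aux ε δ hε hΨ).comp (continuous_inclQuot (epsCentralizer ε δ) A).measurable
  rw [lintegral_congr hinner, lintegral_const_mul J houter, ENNReal.smul_def, smul_eq_mul]
  ring

end TwistedDescent

/-! ## §2 The `GL_n(F)` edition: the `K N A` letter DISCHARGED (★ `exists_quotientMeasure_torus_eq_smul_map`) -/

section TwistedDescentGL

open Literature.MeasureTheory.Group Literature.NumberTheory.Rogawski1990.Ch4Sec10
  Literature.NumberTheory.GaloisRepresentations.IsNonarchimedeanLocalField

/-- **THE ε-TWISTED TORUS DESCENT ON `GL_n(F)`** (`F` a non-archimedean local field; `A = M_{id}` the diagonal torus, `K = GL_n(𝒪)`, `N` the upper unitriangular group, `κ`, `μ_N`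
ANY Haar measures): for `ε : GL_n(F) →* GL_n(F)` continuous and `δ` with closed ε-centraliser `T = G_{δε} ≤ A`, and non-zero invariant Radon `μ_{G∕T}`, `μ_{G∕A}`, `μ_{A∕T}`, there is
ONE `c ∈ (0, ∞)` such that for every module `J` of the twists `n ↦ n (a δ ε(a)⁻¹) ε(n)⁻¹` (`a ∈ A`; binder `hJac` — its VALUE `D_G(N(δ))` is p06's TJ1) and every Borel `F ≥ 0`:
**`∫⁻_{G ⧸ T} F(y δ ε(y)⁻¹) dμ_{G∕T} = c · J · ∫⁻_{A ⧸ T} ∫⁻_{K×N} F(k ((a δ ε(a)⁻¹) n) ε(k)⁻¹) d(κ ⊗ μ_N) dμ_{A∕T}(a)`** — §1 with the `K N A` letter supplied by ★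
`exists_quotientMeasure_torus_eq_smul_map`.  The inner `K × N` integral at `F = T[K] ∘ E` is FILE 1b's `integral_prod_coeff_toVector_twistedConj_frame_eq_gl` (`Theorems/R90S6TwistedConstantTermTransport.lean`: a `GL_n` Satake coefficient).
[cite: Rogawski1990, §4.10 pp. 57–59; §4.13 p. 70] [cite: Gelbart1975, Thm. 9.22 (iii)] [cite: Folland1995, §2.6 Thm. 2.49] -/
theorem exists_lintegral_descEpsConj_eq_mul_lintegral_torus_gl {F : Type*} [Field F] [ValuativeRel F] [TopologicalSpace F] [IsNonarchimedeanLocalField F]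
    {n : ℕ} [MeasurableSpace (GL (Fin n) F)] [BorelSpace (GL (Fin n) F)]
    (ε : GL (Fin n) F →* GL (Fin n) F) (hε : Continuous ε) (δ : GL (Fin n) F)
    {A : Subgroup (GL (Fin n) F)} (hAid : A = standardLeviGL F (_root_.id : Fin n → Fin n))
    (hT : IsClosed (epsCentralizer ε δ : Set (GL (Fin n) F))) (hTA : epsCentralizer ε δ ≤ A)
    [MeasurableSpace (GL (Fin n) F ⧸ epsCentralizer ε δ)] [BorelSpace (GL (Fin n) F ⧸ epsCentralizer ε δ)]
    [MeasurableSpace (GL (Fin n) F ⧸ A)] [BorelSpace (GL (Fin n) F ⧸ A)]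
    [MeasurableSpace (↥A ⧸ (epsCentralizer ε δ).subgroupOf A)] [BorelSpace (↥A ⧸ (epsCentralizer ε δ).subgroupOf A)]
    (μGT : Measure (GL (Fin n) F ⧸ epsCentralizer ε δ)) [SMulInvariantMeasure (GL (Fin n) F) (GL (Fin n) F ⧸ epsCentralizer ε δ) μGT]
    [IsFiniteMeasureOnCompacts μGT] (hGT : μGT ≠ 0)
    (μGA : Measure (GL (Fin n) F ⧸ A)) [SMulInvariantMeasure (GL (Fin n) F) (GL (Fin n) F ⧸ A) μGA] [IsFiniteMeasureOnCompacts μGA] (hGA : μGA ≠ 0)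
    (μAT : Measure (↥A ⧸ (epsCentralizer ε δ).subgroupOf A)) [SMulInvariantMeasure ↥A (↥A ⧸ (epsCentralizer ε δ).subgroupOf A) μAT]
    [IsFiniteMeasureOnCompacts μAT] (hAT : μAT ≠ 0)
    (κ : Measure ↥(glInt n F)) [IsHaarMeasure κ] (μN : Measure ↥(upperUnitriangular (Fin n) F)) [IsHaarMeasure μN] :
    ∃ c : ℝ≥0∞, c ≠ 0 ∧ c ≠ ∞ ∧ ∀ {J : ℝ≥0∞}
      (_hJac : ∀ a : ↥A, ∀ Φ : GL (Fin n) F → ℝ≥0∞, Measurable Φ →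
        ∫⁻ u, Φ ((u : GL (Fin n) F) * ((a : GL (Fin n) F) * δ * (ε (a : GL (Fin n) F))⁻¹) * (ε (u : GL (Fin n) F))⁻¹) ∂μN =
          J * ∫⁻ u, Φ (((a : GL (Fin n) F) * δ * (ε (a : GL (Fin n) F))⁻¹) * (u : GL (Fin n) F)) ∂μN)
      (Fn : GL (Fin n) F → ℝ≥0∞), Measurable Fn →
      ∫⁻ y, descEpsConj ε δ (epsCentralizer ε δ) Fn y ∂μGT =
        c * J * ∫⁻ z, descEpsConj ε δ (epsCentralizer ε δ)
          (fun m : GL (Fin n) F => ∫⁻ q : ↥(glInt n F) × ↥(upperUnitriangular (Fin n) F),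
            Fn ((q.1 : GL (Fin n) F) * (m * (q.2 : GL (Fin n) F)) * (ε (q.1 : GL (Fin n) F))⁻¹) ∂(κ.prod μN))
          (inclQuot (epsCentralizer ε δ) A z) ∂μAT := by
  haveI : T2Space F := (isLocalField F).toT2Space
  haveI : SecondCountableTopology F := secondCountableTopology_localField F
  haveI : LocallyCompactSpace F := (isLocalField F).toLocallyCompactSpace
  haveI : SecondCountableTopology (Matrix (Fin n) (Fin n) F) := inferInstanceAs (SecondCountableTopology (Fin n → Fin n → F))
  haveI : SecondCountableTopology (Matrix (Fin n) (Fin n) F)ᵐᵒᵖ := MulOpposite.opHomeomorph.symm.secondCountableTopology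
  haveI : SecondCountableTopology (GL (Fin n) F) := Units.isEmbedding_embedProduct.secondCountableTopology
  haveI : LocallyCompactSpace (Matrix (Fin n) (Fin n) F) := inferInstanceAs (LocallyCompactSpace (Fin n → Fin n → F))
  haveI : LocallyCompactSpace (GL (Fin n) F) := inferInstance
  haveI : BorelSpace ↥(glInt n F) := Subtype.borelSpace _
  haveI : BorelSpace ↥(upperUnitriangular (Fin n) F) := Subtype.borelSpace _
  haveI : CompactSpace ↥(glInt n F) := isCompact_iff_compactSpace.1 (isCompact_glInt n F)
  haveI : IsFiniteMeasure κ := CompactSpace.isFiniteMeasure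
  haveI : SFinite κ := inferInstance
  haveI : SecondCountableTopology ↥(upperUnitriangular (Fin n) F) := TopologicalSpace.Subtype.secondCountableTopology _
  haveI : LocallyCompactSpace ↥(upperUnitriangular (Fin n) F) := (isClosed_upperUnitriangular (R := F) (n := n)).locallyCompactSpace
  haveI : SFinite μN := inferInstance
  have hA : IsClosed (A : Set (GL (Fin n) F)) := by
    rw [hAid]; exact isClosed_standardLeviGL (R := F) _
  -- `N = upperUnitriangular (Fin n) F` is by definition ★ `unipotentRadicalGL F id` (the currency of the `K N A` theorem): re-key the Haar instance
  have hμN : IsHaarMeasure μN := ‹IsHaarMeasure μN›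
  unfold upperUnitriangular at hμN
  obtain ⟨C, hC, hμGA⟩ := @exists_quotientMeasure_torus_eq_smul_map F _ _ _ _ n _ _ A hAid _ _ μGA _ _ hGA κ _ μN hμN
  obtain ⟨c, hc, hc', key⟩ := exists_lintegral_descEpsConj_eq_mul_lintegral_torus ε δ κ μN hε hA hT hTA μGT hGT μGA hGA μAT hAT hμGA
  refine ⟨c * C, mul_ne_zero hc (ENNReal.coe_ne_zero.2 hC), ENNReal.mul_ne_top hc' ENNReal.coe_ne_top, fun {J} hJac Fn hFn => ?_⟩
  rw [key hJac Fn hFn]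

end TwistedDescentGL

end Summit.HodgeConjecture.HodgeConjecture.R90.S6

end
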